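import Literature.AlgebraicGeometry.HodgeTheory.CyclicReflectionEigencomponents
import HarnessLib

/-!
# The eigenspaces `H(ζ^j)` are spanned by the eigencomponents of the vanishing vectors
# (Carlson–Toledo 1999, §7: "`Γ` acts transitively on the `δ_i`, which span `H_{ζ^i}`") — packaging, part 7

Family `hodge`, layer `Literature/AlgebraicGeometry/HodgeTheory`. THEOREMS only. Sequel of
`CyclicReflectionEigencomponents`, for crux K1 of
`Summits/HodgeConjecture/HodgeConjecture/Theses/CyclicUnitaryPowers.lean` (lane D glue: hypotheses `hspan`,
`hstab`, `htrans` of the unitary-reflection density theorem at the place `E_j = H(ζ^j)`):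
* `cyclicEigenProjector_one_tmul_pow_apply` — `π_j(1 ⊗ τ^i δ) = ζ^{ij} δ_j`;
* `exists_cyclicEigenProjector_one_tmul_eq_smul` — for `x` in the cyclic span `W_δ`, `π_j(1 ⊗ x) ∈ ℂ δ_j`;
* `span_eigencomponent_eq_eigenspace` — if the vanishing vectors of `R` span the vanishing part of `V`
  (clause P5 of statement D), then `H(ζ^j) = span_ℂ {δ_j(δ) : δ ∈ R}` for `1 ≤ j < p`;
* `baseChange_eigencomponent_of_comm` — `γ_ℂ δ_j(δ) = δ_j(γ δ)` for `γ` commuting with `τ`, whence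
  `exists_baseChange_eigencomponent_eq_smul` (`γ δ' ∈ W_δ ⇒ γ_ℂ δ_j(δ') ∈ ℂ δ_j(δ)`) and the scaling rule
  `hermitianOfBilin_smul_smul` for the signs `h(δ_j, δ_j)`.
Written by the prover seat `hodge-nonav-prover-Ax`.

## References
* [CarlsonToledo1999] J. A. Carlson, D. Toledo, *Discriminant complements and kernels of monodromy
  representations*, Duke Math. J. 97 (1999), §7 (p. 16), §6 (pp. 13–14), §2 (p. 5).
-/

noncomputable section

open Module Literature.AlgebraicGeometry.Motives
open scoped TensorProduct ComplexConjugate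

namespace Literature.AlgebraicGeometry.HodgeTheory

universe v

variable {V : Type v} [AddCommGroup V] [Module ℚ V]

/-! ### §1 `π_j(1 ⊗ τ^i δ) = ζ^{ij} δ_j` -/

/-- Two distinct naturals below `p` are not congruent modulo `p`. [cite: CarlsonToledo1999, §7 (p. 16)] -/
theorem not_intCast_dvd_sub_of_lt {p m j : ℕ} (hm : m < p) (hj : j < p) (hmj : m ≠ j) :
    ¬ (p : ℤ) ∣ (m : ℤ) - j := by
  intro h
  have h0 : (m : ℤ) - j = 0 := by
    refine Int.eq_zero_of_abs_lt_dvd h ?_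
    rw [abs_lt]
    constructor <;> omega
  omega

/-- **`π_j(1 ⊗ τ^i δ) = ζ^{ij} δ_j`** (`ζ` primitive, `τ^p = 1`, `j < p`). [cite: CarlsonToledo1999, §7 (p. 16)] -/
theorem cyclicEigenProjector_one_tmul_pow_apply {τ : V →ₗ[ℚ] V} {p : ℕ} (hτ : τ ^ p = 1) {ζ : ℂ}
    (hζ : IsPrimitiveRoot ζ p) (hp : 0 < p) (i : ℕ) {j : ℕ} (hj : j < p) (δ : V) :
    cyclicEigenProjector τ p ζ j ((1 : ℂ) ⊗ₜ ((τ ^ i) δ)) = ζ ^ (i * j) • eigencomponent τ p ζ j δ := by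
  have hζ0 : ζ ≠ 0 := hζ.ne_zero hp.ne'
  rw [tmul_pow_apply_eq_sum_eigencomponent hτ hζ hp i δ, map_sum, Finset.sum_eq_single j]
  · rw [map_smul, cyclicEigenProjector_apply_of_mem_eigenspace_self hp.ne' hζ0 j
      (eigencomponent_mem_eigenspace hτ hζ.pow_eq_one hζ0 j δ)]
  · intro m hm hmj
    rw [map_smul, cyclicEigenProjector_apply_of_mem_eigenspace_of_ne hζ hp
      (not_intCast_dvd_sub_of_lt (Finset.mem_range.1 hm) hj hmj) (eigencomponent_mem_eigenspace hτ hζ.pow_eq_one hζ0 m δ),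
      smul_zero]
  · intro hj'
    exact absurd (Finset.mem_range.2 hj) hj'

/-! ### §2 The `H(ζ^j)`-component of the cyclic span is the line `ℂ δ_j` -/

/-- **For `x` in the cyclic span `W_δ = span_ℚ {τ^i δ}`, `π_j(1 ⊗ x)` is a multiple of `δ_j`**
(`(W_δ ⊗ ℂ) ∩ H(ζ^j) = ℂ δ_j`: "`V(δ) ⊗ ℂ = ⊕_i ℂ δ_i`"). [cite: CarlsonToledo1999, §6 (pp. 13–14)] -/
theorem exists_cyclicEigenProjector_one_tmul_eq_smul {τ : V →ₗ[ℚ] V} {p : ℕ} (hτ : τ ^ p = 1) {ζ : ℂ}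
    (hζ : IsPrimitiveRoot ζ p) (hp : 0 < p) {j : ℕ} (hj : j < p) (δ : V) {x : V}
    (hx : x ∈ Submodule.span ℚ (Set.range fun i : ℕ => (τ ^ i) δ)) :
    ∃ c : ℂ, cyclicEigenProjector τ p ζ j ((1 : ℂ) ⊗ₜ x) = c • eigencomponent τ p ζ j δ := by
  induction hx using Submodule.span_induction with
  | mem x hx =>
    obtain ⟨i, rfl⟩ := hx
    exact ⟨ζ ^ (i * j), cyclicEigenProjector_one_tmul_pow_apply hτ hζ hp i hj δ⟩
  | zero => exact ⟨0, by simp⟩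
  | add x y _ _ hx hy =>
    obtain ⟨c, hc⟩ := hx
    obtain ⟨d, hd⟩ := hy
    exact ⟨c + d, by rw [TensorProduct.tmul_add, map_add, hc, hd, add_smul]⟩
  | smul a x _ hx =>
    obtain ⟨c, hc⟩ := hx
    refine ⟨algebraMap ℚ ℂ a * c, ?_⟩
    rw [TensorProduct.tmul_smul, ← algebraMap_smul ℂ a, map_smul, hc, smul_smul]

/-! ### §3 `H(ζ^j) = span_ℂ {δ_j(δ) : δ ∈ R}` -/

/-- `Σ_{i<p} τ^{i+1} v = Σ_{i<p} τ^i v` for `τ^p = 1`. [cite: CarlsonToledo1999, §6 (p. 13)] -/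
theorem sum_pow_succ_apply_eq {τ : V →ₗ[ℚ] V} {p : ℕ} (hτ : τ ^ p = 1) (v : V) :
    ∑ i ∈ Finset.range p, (τ ^ (i + 1)) v = ∑ i ∈ Finset.range p, (τ ^ i) v := by
  have h1 := Finset.sum_range_succ' (fun i => (τ ^ i) v) p
  have h2 := Finset.sum_range_succ (fun i => (τ ^ i) v) p
  rw [hτ, pow_zero] at *
  rw [h2] at h1
  exact (add_right_cancel h1).symm

/-- The average `v₀ = Σ_{i<p} τ^i v` is `τ`-invariant. [cite: CarlsonToledo1999, §6 (p. 13)] -/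
theorem apply_sum_pow_apply {τ : V →ₗ[ℚ] V} {p : ℕ} (hτ : τ ^ p = 1) (v : V) :
    τ (∑ i ∈ Finset.range p, (τ ^ i) v) = ∑ i ∈ Finset.range p, (τ ^ i) v := by
  rw [map_sum]
  have h : ∀ i, τ ((τ ^ i) v) = (τ ^ (i + 1)) v := fun i => by rw [pow_succ', Module.End.mul_apply]
  simp only [h]
  exact sum_pow_succ_apply_eq hτ v

/-- **`v - (1/p) Σ τ^i v` is a vanishing vector**: `Σ_{i<p} τ^i (v - (1/p) Σ_k τ^k v) = 0`.
[cite: CarlsonToledo1999, §6 (p. 13)] -/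
theorem sum_pow_apply_sub_average {τ : V →ₗ[ℚ] V} {p : ℕ} (hτ : τ ^ p = 1) (hp : 0 < p) (v : V) :
    ∑ i ∈ Finset.range p, (τ ^ i) (v - (p : ℚ)⁻¹ • ∑ k ∈ Finset.range p, (τ ^ k) v) = 0 := by
  have hinv : ∀ i : ℕ, (τ ^ i) (∑ k ∈ Finset.range p, (τ ^ k) v) = ∑ k ∈ Finset.range p, (τ ^ k) v := by
    intro i
    induction i with
    | zero => simp
    | succ i ih => rw [pow_succ', Module.End.mul_apply, ih, apply_sum_pow_apply hτ]
  simp only [map_sub, map_smul, hinv, Finset.sum_sub_distrib, Finset.sum_const, Finset.card_range]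
  rw [← Nat.cast_smul_eq_nsmul ℚ, smul_smul, mul_inv_cancel₀ (by exact_mod_cast hp.ne'), one_smul, sub_self]

/-- `1 ⊗ (Σ τ^i v)` lies in the eigenspace `H(1) = H(ζ^0)`. [cite: CarlsonToledo1999, §6 (p. 13)] -/
theorem one_tmul_sum_pow_apply_mem_eigenspace {τ : V →ₗ[ℚ] V} {p : ℕ} (hτ : τ ^ p = 1) (ζ : ℂ) (v : V) :
    (1 : ℂ) ⊗ₜ[ℚ] (∑ i ∈ Finset.range p, (τ ^ i) v) ∈ Module.End.eigenspace (τ.baseChange ℂ) (ζ ^ 0) := by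
  rw [Module.End.mem_eigenspace_iff, pow_zero, one_smul, LinearMap.baseChange_tmul, apply_sum_pow_apply hτ]

/-- `1 ⊗ x ∈ span_ℂ (1 ⊗ T)` for `x ∈ span_ℚ T`. [cite: CarlsonToledo1999, §2 (p. 5)] -/
theorem one_tmul_mem_span_image {T : Set V} {x : V} (hx : x ∈ Submodule.span ℚ T) :
    (1 : ℂ) ⊗ₜ[ℚ] x ∈ Submodule.span ℂ ((fun v : V => (1 : ℂ) ⊗ₜ[ℚ] v) '' T) := by
  have h1 : (TensorProduct.mk ℚ ℂ V 1) x ∈ (Submodule.span ℚ T).map (TensorProduct.mk ℚ ℂ V 1) :=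
    Submodule.mem_map_of_mem hx
  rw [Submodule.map_span] at h1
  exact Submodule.span_le_restrictScalars ℚ ℂ _ h1

/-- **`H(ζ^j) = span_ℂ {δ_j(δ) : δ ∈ R}` for `1 ≤ j < p`**, when every vanishing vector (`Σ τ^i x = 0`) lies in
the span of the translates `τ^i δ`, `δ ∈ R` (clause P5 of statement D; for the universal family the vanishing
cycles span the vanishing cohomology): the `δ_j` span the eigenspace, as used for the density theorem
("which span `H_{ζ^i}`"). [cite: CarlsonToledo1999, §7 (p. 16)] -/
theorem span_eigencomponent_eq_eigenspace {τ : V →ₗ[ℚ] V} {p : ℕ} (hτ : τ ^ p = 1) {ζ : ℂ}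
    (hζ : IsPrimitiveRoot ζ p) (hp : 0 < p) {R : Set V}
    (hR : ∀ x : V, ∑ i ∈ Finset.range p, (τ ^ i) x = 0 →
      x ∈ Submodule.span ℚ {y | ∃ δ ∈ R, ∃ i : ℕ, y = (τ ^ i) δ})
    {j : ℕ} (hj1 : 1 ≤ j) (hjp : j < p) :
    Submodule.span ℂ {e | ∃ δ ∈ R, e = eigencomponent τ p ζ j δ} = Module.End.eigenspace (τ.baseChange ℂ) (ζ ^ j) := by
  have hζ0 : ζ ≠ 0 := hζ.ne_zero hp.ne'
  refine le_antisymm (Submodule.span_le.2 ?_) fun y hy => ?_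
  · rintro _ ⟨δ, _, rfl⟩
    exact eigencomponent_mem_eigenspace hτ hζ.pow_eq_one hζ0 j δ
  · -- `y = π_j y`, and `π_j z` lies in the span for every `z`
    have hall : ∀ z : ℂ ⊗[ℚ] V, cyclicEigenProjector τ p ζ j z ∈
        Submodule.span ℂ {e | ∃ δ ∈ R, e = eigencomponent τ p ζ j δ} := by
      intro z
      induction z using TensorProduct.induction_on with
      | zero => rw [map_zero]; exact Submodule.zero_mem _
      | tmul a v =>
        rw [show a ⊗ₜ[ℚ] v = a • ((1 : ℂ) ⊗ₜ[ℚ] v) by rw [TensorProduct.smul_tmul', smul_eq_mul, mul_one], map_smul]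
        refine Submodule.smul_mem _ a ?_
        -- split `v` into its vanishing part and its average
        set v₀ : V := (p : ℚ)⁻¹ • ∑ k ∈ Finset.range p, (τ ^ k) v with hv₀
        have hsplit : (1 : ℂ) ⊗ₜ[ℚ] v = (1 : ℂ) ⊗ₜ[ℚ] (v - v₀) + (1 : ℂ) ⊗ₜ[ℚ] v₀ := by
          rw [← TensorProduct.tmul_add, sub_add_cancel]
        have hinv : cyclicEigenProjector τ p ζ j ((1 : ℂ) ⊗ₜ[ℚ] v₀) = 0 := by
          have hmem : (1 : ℂ) ⊗ₜ[ℚ] v₀ ∈ Module.End.eigenspace (τ.baseChange ℂ) (ζ ^ 0) := by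
            rw [hv₀, TensorProduct.tmul_smul, ← algebraMap_smul ℂ ((p : ℚ)⁻¹)]
            exact Submodule.smul_mem _ _ (one_tmul_sum_pow_apply_mem_eigenspace hτ ζ v)
          exact cyclicEigenProjector_apply_of_mem_eigenspace_of_ne hζ hp
            (not_intCast_dvd_sub_of_lt hp hjp (by omega)) hmem
        rw [hsplit, map_add, hinv, add_zero]
        -- the vanishing part lies in the span of the translates of the `δ ∈ R`
        have hvan := hR (v - v₀) (sum_pow_apply_sub_average hτ hp v)
        have hmem := one_tmul_mem_span_image (V := V) hvan
        have hle : Submodule.span ℂ ((fun w : V => (1 : ℂ) ⊗ₜ[ℚ] w) '' {y | ∃ δ ∈ R, ∃ i : ℕ, y = (τ ^ i) δ}) ≤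
            (Submodule.span ℂ {e | ∃ δ ∈ R, e = eigencomponent τ p ζ j δ}).comap (cyclicEigenProjector τ p ζ j) := by
          refine Submodule.span_le.2 ?_
          rintro _ ⟨_, ⟨δ, hδ, i, rfl⟩, rfl⟩
          rw [SetLike.mem_coe, Submodule.mem_comap, cyclicEigenProjector_one_tmul_pow_apply hτ hζ hp i hjp δ]
          exact Submodule.smul_mem _ _ (Submodule.subset_span ⟨δ, hδ, rfl⟩)
        exact Submodule.mem_comap.1 (hle hmem)
      | add z w hz hw => rw [map_add]; exact Submodule.add_mem _ hz hw
    rw [← cyclicEigenProjector_apply_of_mem_eigenspace_self hp.ne' hζ0 j hy]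
    exact hall y

/-! ### §4 The action of `Γ` on the eigencomponents -/

/-- **`γ_ℂ δ_j(δ) = δ_j(γ δ)`** for `γ` commuting with `τ` (`π_j` is a polynomial in `τ_ℂ`).
[cite: CarlsonToledo1999, §2 (p. 5) and §7 (p. 16)] -/
theorem baseChange_eigencomponent_of_comm {τ γ : V →ₗ[ℚ] V} (hc : γ ∘ₗ τ = τ ∘ₗ γ) (p : ℕ) (ζ : ℂ) (j : ℕ)
    (δ : V) : γ.baseChange ℂ (eigencomponent τ p ζ j δ) = eigencomponent τ p ζ j (γ δ) := by
  have hcomm : γ.baseChange ℂ ∘ₗ τ.baseChange ℂ = τ.baseChange ℂ ∘ₗ γ.baseChange ℂ := by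
    rw [← LinearMap.baseChange_comp, ← LinearMap.baseChange_comp, hc]
  have h := congrArg (fun f => f ((1 : ℂ) ⊗ₜ[ℚ] δ)) (comp_cyclicEigenProjector_of_comm hcomm p ζ j)
  simp only [LinearMap.coe_comp, Function.comp_apply, LinearMap.baseChange_tmul] at h
  rw [eigencomponent_def, eigencomponent_def]
  exact h

/-- **`γ δ' ∈ W_δ ⇒ γ_ℂ δ_j(δ') ∈ ℂ δ_j(δ)`** (`γ` commuting with `τ`): the transitivity clause P4 of statement D
read on the eigencomponents. [cite: CarlsonToledo1999, §7 (p. 16)] -/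
theorem exists_baseChange_eigencomponent_eq_smul {τ γ : V →ₗ[ℚ] V} (hc : γ ∘ₗ τ = τ ∘ₗ γ) {p : ℕ}
    (hτ : τ ^ p = 1) {ζ : ℂ} (hζ : IsPrimitiveRoot ζ p) (hp : 0 < p) {j : ℕ} (hj : j < p) {δ δ' : V}
    (hγ : γ δ' ∈ Submodule.span ℚ (Set.range fun i : ℕ => (τ ^ i) δ)) :
    ∃ c : ℂ, γ.baseChange ℂ (eigencomponent τ p ζ j δ') = c • eigencomponent τ p ζ j δ := by
  rw [baseChange_eigencomponent_of_comm hc, eigencomponent_def]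
  exact exists_cyclicEigenProjector_one_tmul_eq_smul hτ hζ hp hj δ hγ

/-- Scaling of the hermitian form: `h(c x, c y) = (c̄ c) h(x, y)` — so `h(δ, δ)` and `h(cδ, cδ)` have the same
sign for `c ≠ 0`. [cite: CarlsonToledo1999, §5 (p. 11)] -/
theorem hermitianOfBilin_smul_smul (B : LinearMap.BilinForm ℚ V) (c : ℂ) (x y : ℂ ⊗[ℚ] V) :
    hermitianOfBilin B (c • x) (c • y) = (conj c * c) * hermitianOfBilin B x y := by
  rw [LinearMap.map_smulₛₗ₂, map_smul, smul_eq_mul, smul_eq_mul, starRingEnd_apply, mul_assoc]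

end Literature.AlgebraicGeometry.HodgeTheory

end
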